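import Summits.CriticalPhenomena.SAWScalingLimit.Theorems.SAWLeftRightFKGFKGToTraversalBoundShellIterationGeometry

/-!
# Tight lattice crossings as sub-walks inside the lattice annulus
(crux `SAWLeftRightFKG.FKGToTraversalBound`, stmt-CriticalPhenomena-1878; line `excursion-domination`,
geometric core of the registered stub `stub_shellIterationCore`, part 2)

Part 1 (`…ShellIterationGeometry`) turns `k` separate traversals of a shell `D(x; ρ, R)` by the mesh
polyline of a lattice walk `p` into `k` TIGHT INDEX WINDOWS `i m < j m ≤ p.length`: end sites on
opposite sides of `D(x; ρ + δ, R - δ)`, interior sites strictly inside the open annulus.  The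
Kemppainen–Smirnov iteration reads such a crossing as a LATTICE PATH: the component of the lattice
annulus it runs in, the collar around it, the sites it kills.  This file packages the windows as
honest sub-walks (`SimpleGraph.Walk.IsSubwalk`, the form of the line's collar statements
`IsCollaredOff` / `stub_killedWalkUnforcedPassage`):

* `exists_subwalk_window` — the vertices `p.getVert n, …, p.getVert n'` (`n ≤ n' ≤ p.length`) form a
  sub-walk of `p` of length `n' - n`, with the expected `getVert`; `exists_subwalk_window_forall` —
  hence a property of all vertices of the window is a property of all support sites of the sub-walk;
* `exists_passages_of_hasTraversals_toCurve` (generic graph with `ε`-short embedded edges) and the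
  registered `ℤ²` form `latticePassages_of_hasTraversals_toCurve` — `k` separate traversals of
  `D(x; ρ, R)` by the polyline, `ρ + 3ε < R`, give `k` PASSAGES: sub-walks `c m` of `p`, filling the
  interiors `i m < · < j m` of weakly increasing index windows, every support site of which is
  embedded strictly inside the open annulus `ρ + ε < |· - x| < R - ε`, entering it within `ε` of one
  rim and leaving it within `ε` of the other (one-step bound along edges).

References: M. Aizenman, A. Burchard, Duke Math. J. 99 (1999) §3.a; A. Kemppainen, S. Smirnov,
Ann. Probab. 45 (2017) §2.2, §3.2 (crossings of annuli as sub-paths).  All statements folklore.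
-/

noncomputable section

open Set Metric
open scoped unitInterval
open Literature.Probability.RandomPlanarGeometry Literature.Probability.LatticeModels

namespace Summit.CriticalPhenomena.SAWScalingLimit.Theorems.FKGToTraversalBound.ExcursionDomination.ShellIteration

/-! ### Index windows as sub-walks -/

section Window

variable {V : Type*} {G : SimpleGraph V} {u v : V}

/-- **Window sub-walk.** For indices `n ≤ n' ≤ p.length`, the vertices `p.getVert n, …, p.getVert n'`
of a walk `p` form a contiguous sub-walk of `p` of length `n' - n` whose `m`-th vertex is
`p.getVert (n + min m (n' - n))` (`Walk.drop` then `Walk.take`). [folklore] -/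
theorem exists_subwalk_window (p : G.Walk u v) {n n' : ℕ} (hnn' : n ≤ n') (hn' : n' ≤ p.length) :
    ∃ q : G.Walk (p.getVert n) (p.getVert n'), q.IsSubwalk p ∧ q.length = n' - n ∧
      ∀ m, q.getVert m = p.getVert (n + min m (n' - n)) := by
  have hend : (p.drop n).getVert (n' - n) = p.getVert n' := by
    rw [SimpleGraph.Walk.drop_getVert, Nat.add_sub_cancel' hnn']
  refine ⟨((p.drop n).take (n' - n)).copy rfl hend, ?_, ?_, fun m => ?_⟩
  · have h := ((SimpleGraph.Walk.isSubwalk_take (p.drop n) (n' - n)).trans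
      (SimpleGraph.Walk.isSubwalk_drop p n)).copy rfl hend rfl rfl
    simpa using h
  · rw [SimpleGraph.Walk.length_copy, SimpleGraph.Walk.take_length, SimpleGraph.Walk.drop_length]
    omega
  · rw [SimpleGraph.Walk.getVert_copy, SimpleGraph.Walk.take_getVert, SimpleGraph.Walk.drop_getVert,
      Nat.min_comm]

/-- **Window sub-walk with a property.** If every vertex `p.getVert m`, `n ≤ m ≤ n'`
(`n' ≤ p.length`), satisfies `P`, the window is a sub-walk of `p` of length `n' - n` all of whose
support vertices satisfy `P`. [folklore] -/
theorem exists_subwalk_window_forall (p : G.Walk u v) {n n' : ℕ} (hnn' : n ≤ n')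
    (hn' : n' ≤ p.length) {P : V → Prop} (hP : ∀ m, n ≤ m → m ≤ n' → P (p.getVert m)) :
    ∃ q : G.Walk (p.getVert n) (p.getVert n'), q.IsSubwalk p ∧ q.length = n' - n ∧
      ∀ s ∈ q.support, P s := by
  obtain ⟨q, hq, hlen, hget⟩ := exists_subwalk_window p hnn' hn'
  refine ⟨q, hq, hlen, fun s hs => ?_⟩
  obtain ⟨m, rfl, -⟩ := SimpleGraph.Walk.mem_support_iff_exists_getVert.1 hs
  rw [hget]
  exact hP _ (Nat.le_add_right _ _) (by omega)

end Window

/-! ### Passages: tight crossings as sub-walks inside the open annulus -/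

section Generic

variable {V E : Type*} {G : SimpleGraph V} {u v : V}

/-- **One-step bound.** With `ε`-short embedded edges, the distances to `x` of consecutive vertices
of a walk differ by at most `ε`. [folklore] -/
theorem abs_dist_getVert_succ_sub_le [PseudoMetricSpace E] {ε : ℝ} (emb : V → E)
    (hG : ∀ ⦃a b : V⦄, G.Adj a b → dist (emb a) (emb b) ≤ ε) (p : G.Walk u v) (x : E) {n : ℕ}
    (hn : n < p.length) :
    |dist (emb (p.getVert (n + 1))) x - dist (emb (p.getVert n)) x| ≤ ε :=
  (abs_dist_sub_le _ _ _).trans (by rw [dist_comm]; exact hG (p.adj_getVert_succ hn))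

variable [NormedAddCommGroup E] [NormedSpace ℝ E]

/-- **Separate traversals of the polyline give passages of the open annulus.** Let the edges of `G`
be `ε`-short under `emb` (`ε ≥ 0`) and let the polyline of the walk `p` traverse `D(x; ρ, R)` by `k`
separate segments, `ρ + 3ε < R`. Then there are weakly increasing index windows
`i m + 2 ≤ j m ≤ p.length` (`j m ≤ i m'` for `m < m'`), end vertices embedded on opposite sides of
`D(x; ρ + ε, R - ε)`, and for each `m` a sub-walk `c` of `p` of length `j m - i m - 2` from
`p.getVert (i m + 1)` to `p.getVert (j m - 1)` (the interior of the window) every support vertex of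
which is embedded strictly inside the open annulus `ρ + ε < |· - x| < R - ε`, starting within
`ρ + 2ε` of `x` and ending at distance `≥ R - 2ε` (or the mirror clause, matching the window).
[cite: AizenmanBurchardDuke1999, §3.a] -/
theorem exists_passages_of_hasTraversals_toCurve {ε : ℝ} (hε : 0 ≤ ε) (emb : V → E)
    (hG : ∀ ⦃a b : V⦄, G.Adj a b → dist (emb a) (emb b) ≤ ε) (p : G.Walk u v) {k : ℕ} {x : E}
    {ρ R : ℝ} (hρR : ρ + 3 * ε < R) (h : (⟨p.toCurve emb⟩ : Curve E).HasTraversals k x ρ R) :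
    ∃ i j : Fin k → ℕ, (∀ m, i m + 2 ≤ j m) ∧ (∀ m, j m ≤ p.length) ∧
      (∀ ⦃m m'⦄, m < m' → j m ≤ i m') ∧
      ∀ m, ((dist (emb (p.getVert (i m))) x ≤ ρ + ε ∧ R - ε ≤ dist (emb (p.getVert (j m))) x ∧
          dist (emb (p.getVert (i m + 1))) x ≤ ρ + 2 * ε ∧
          R - 2 * ε ≤ dist (emb (p.getVert (j m - 1))) x) ∨
        (R - ε ≤ dist (emb (p.getVert (i m))) x ∧ dist (emb (p.getVert (j m))) x ≤ ρ + ε ∧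
          R - 2 * ε ≤ dist (emb (p.getVert (i m + 1))) x ∧
          dist (emb (p.getVert (j m - 1))) x ≤ ρ + 2 * ε)) ∧
        ∃ c : G.Walk (p.getVert (i m + 1)) (p.getVert (j m - 1)), c.IsSubwalk p ∧
          c.length + 2 = j m - i m ∧
          ∀ s ∈ c.support, ρ + ε < dist (emb s) x ∧ dist (emb s) x < R - ε := by
  obtain ⟨i, j, hij, hj, hside, hint, hsep⟩ :=
    exists_tightIndexTraversals_of_hasTraversals_toCurve hε emb hG p (by linarith) h
  -- the one-step bound along the walk
  have hstep : ∀ n, n < p.length →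
      |dist (emb (p.getVert (n + 1))) x - dist (emb (p.getVert n)) x| ≤ ε := fun n hn =>
    abs_dist_getVert_succ_sub_le emb hG p x hn
  -- each window has at least one interior vertex
  have htwo : ∀ m, i m + 2 ≤ j m := by
    intro m
    by_contra hlt
    have hj1 : j m = i m + 1 := by have := hij m; omega
    have hb := abs_le.1 (hstep (i m) (by have := hj m; omega))
    rw [← hj1] at hb
    rcases hside m with ⟨h1, h2⟩ | ⟨h1, h2⟩ <;> linarith [hb.1, hb.2]
  refine ⟨i, j, htwo, hj, hsep, fun m => ⟨?_, ?_⟩⟩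
  · have hb1 := abs_le.1 (hstep (i m) (by have := hj m; have := htwo m; omega))
    have hb2 := abs_le.1 (hstep (j m - 1) (by have := hj m; have := htwo m; omega))
    have hj1 : j m - 1 + 1 = j m := by have := htwo m; omega
    rw [hj1] at hb2
    rcases hside m with ⟨h1, h2⟩ | ⟨h1, h2⟩
    · exact Or.inl ⟨h1, h2, by linarith [hb1.2], by linarith [hb2.2]⟩
    · exact Or.inr ⟨h1, h2, by linarith [hb1.1], by linarith [hb2.1]⟩
  · obtain ⟨c, hc, hlen, hsupp⟩ := exists_subwalk_window_forall p (n := i m + 1) (n' := j m - 1)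
      (by have := htwo m; omega) (by have := hj m; omega)
      (P := fun s => ρ + ε < dist (emb s) x ∧ dist (emb s) x < R - ε)
      (fun n hn hn' => hint m n (by omega) (by have := htwo m; omega))
    exact ⟨c, hc, by have := htwo m; omega, hsupp⟩

end Generic

/-! ### The `ℤ²` form (registered sub-goal of `stub_shellIterationCore`) -/

/-- **Passages of the lattice annulus (registered).** For a walk `p` of a sub-graph of `ℤ²` at mesh
`δ ≥ 0` whose mesh polyline traverses `D(x; ρ, R)` by `k` separate segments, `ρ + 3δ < R`: `k` weakly
increasing index windows `i m + 2 ≤ j m ≤ p.length` whose end sites lie on opposite sides of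
`D(x; ρ + δ, R - δ)`, and for each a sub-walk of `p` filling the interior of the window, all of whose
sites have mesh points strictly inside the open annulus `ρ + δ < |· - x| < R - δ`, entering it within
`δ` of one rim and leaving within `δ` of the other. This is the lattice object the Kemppainen–Smirnov
iteration observes: a crossing of the middle annulus as a lattice path inside ONE component of the
lattice annulus off the past. [cite: AizenmanBurchardDuke1999, §3.a] -/
theorem latticePassages_of_hasTraversals_toCurve :
    ∀ {G : SimpleGraph (Site 2)} {u v : Site 2} (δ : ℝ) (p : G.Walk u v) (k : ℕ) (x : ℂ) (ρ R : ℝ),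
      G ≤ zdGraph 2 → 0 ≤ δ → ρ + 3 * δ < R →
      (⟨p.toCurve (meshPoint δ)⟩ : Curve ℂ).HasTraversals k x ρ R →
      ∃ i j : Fin k → ℕ, (∀ m, i m + 2 ≤ j m) ∧ (∀ m, j m ≤ p.length) ∧
        (∀ ⦃m m'⦄, m < m' → j m ≤ i m') ∧
        ∀ m, ((dist (meshPoint δ (p.getVert (i m))) x ≤ ρ + δ ∧
              R - δ ≤ dist (meshPoint δ (p.getVert (j m))) x ∧
              dist (meshPoint δ (p.getVert (i m + 1))) x ≤ ρ + 2 * δ ∧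
              R - 2 * δ ≤ dist (meshPoint δ (p.getVert (j m - 1))) x) ∨
            (R - δ ≤ dist (meshPoint δ (p.getVert (i m))) x ∧
              dist (meshPoint δ (p.getVert (j m))) x ≤ ρ + δ ∧
              R - 2 * δ ≤ dist (meshPoint δ (p.getVert (i m + 1))) x ∧
              dist (meshPoint δ (p.getVert (j m - 1))) x ≤ ρ + 2 * δ)) ∧
          ∃ c : G.Walk (p.getVert (i m + 1)) (p.getVert (j m - 1)), c.IsSubwalk p ∧
            c.length + 2 = j m - i m ∧
            ∀ s ∈ c.support, ρ + δ < dist (meshPoint δ s) x ∧ dist (meshPoint δ s) x < R - δ :=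
  fun _ p _ _ _ _ hG hδ hρR h =>
    exists_passages_of_hasTraversals_toCurve hδ _ (dist_meshPoint_le_of_le_zdGraph hG hδ) p hρR h

end Summit.CriticalPhenomena.SAWScalingLimit.Theorems.FKGToTraversalBound.ExcursionDomination.ShellIteration
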